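import Mathlib
import Summits.NavierStokesRegularity.NavierStokesRegularity.Theorems.SymmetryModuliCountFarPastLedgerSliceNear
import HarnessLib

/-!
# Slice pressure, tools for the local identity (crux `FarPastLedger`, line `uloc-gronwall-transplant`)

Helper file for the lead's stub `stub_fplSlicePressure` of crux stmt-NavierStokesRegularity-14060
(`SymmetryModuliCount.FarPastLedger`): the truncation bumps `g_ρ(y) = θ((y - x₀)/ρ)` (smooth,
`|g_ρ| ≤ 1`, `= 1` on `B̄(x₀,ρ)`, `= 0` off `B(x₀,2ρ)`, eventually `1` at every point) and the
`L¹(B_ρ)` bookkeeping `∫_{B(x₀,ρ)} |q - p₁ - Q| ≤ L|B₁|ρ⁴ + (|q x₀||B₁| + 4√(|B₁|P))ρ³` from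
`|q| ≤ |q x₀| + Lρ` on the ball and `∫ p₁² ≤ Pρ³`, `∫ Q² ≤ 9Pρ³` (Cauchy–Schwarz).
-/

noncomputable section

open MeasureTheory Set Filter Metric Topology
open scoped ContDiff Laplacian

set_option linter.dupNamespace false -- nested layout Summit.<S>.<Sub>, Sub = S (D-0017)

namespace Summit.NavierStokesRegularity.NavierStokesRegularity.Theorems

open Literature.Analysis.FluidPDE

-- nested operator types `E →L[ℝ] E →L[ℝ] E →L[ℝ] ℝ`
set_option maxSynthPendingDepth 3

/-! ### The truncation bumps `g_ρ(y) = θ((y - x₀)/ρ)` -/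

/-- The truncation bump at scale `ρ` about `x₀`: `θ(ρ⁻¹(y - x₀))`, `θ` Mathlib's bump with
`rIn = 1`, `rOut = 2` at the origin. Smooth for `ρ ≠ 0`. -/
theorem fpl_trunc_contDiff (x₀ : EuclideanSpace ℝ (Fin 3)) {ρ : ℝ} :
    ContDiff ℝ ∞ fun y : EuclideanSpace ℝ (Fin 3) =>
      ((⟨1, 2, zero_lt_one, one_lt_two⟩ : ContDiffBump (0 : EuclideanSpace ℝ (Fin 3))) :
        EuclideanSpace ℝ (Fin 3) → ℝ) (ρ⁻¹ • (y - x₀)) :=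
  (ContDiffBump.contDiff _).comp ((contDiff_id.sub contDiff_const).const_smul _)

/-- `0 ≤ g_ρ ≤ 1`, hence `|g_ρ| ≤ 1`. -/
theorem fpl_trunc_abs_le_one (x₀ : EuclideanSpace ℝ (Fin 3)) (ρ : ℝ) (y : EuclideanSpace ℝ (Fin 3)) :
    |((⟨1, 2, zero_lt_one, one_lt_two⟩ : ContDiffBump (0 : EuclideanSpace ℝ (Fin 3))) :
        EuclideanSpace ℝ (Fin 3) → ℝ) (ρ⁻¹ • (y - x₀))| ≤ 1 := by
  rw [abs_of_nonneg (ContDiffBump.nonneg _)]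
  exact ContDiffBump.le_one _

/-- `g_ρ = 1` on `B̄(x₀, ρ)` for `ρ > 0`. -/
theorem fpl_trunc_eq_one {x₀ : EuclideanSpace ℝ (Fin 3)} {ρ : ℝ} (hρ : 0 < ρ)
    {y : EuclideanSpace ℝ (Fin 3)} (hy : y ∈ closedBall x₀ ρ) :
    ((⟨1, 2, zero_lt_one, one_lt_two⟩ : ContDiffBump (0 : EuclideanSpace ℝ (Fin 3))) :
        EuclideanSpace ℝ (Fin 3) → ℝ) (ρ⁻¹ • (y - x₀)) = 1 := by
  refine ContDiffBump.one_of_mem_closedBall _ ?_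
  rw [mem_closedBall, dist_zero_right, norm_smul, norm_inv, Real.norm_of_nonneg hρ.le]
  rw [mem_closedBall, dist_eq_norm] at hy
  rw [inv_mul_le_iff₀ hρ]
  simpa using hy

/-- `g_ρ = 0` off `B(x₀, 2ρ)` for `ρ > 0`. -/
theorem fpl_trunc_eq_zero {x₀ : EuclideanSpace ℝ (Fin 3)} {ρ : ℝ} (hρ : 0 < ρ)
    {y : EuclideanSpace ℝ (Fin 3)} (hy : y ∉ ball x₀ (2 * ρ)) :
    ((⟨1, 2, zero_lt_one, one_lt_two⟩ : ContDiffBump (0 : EuclideanSpace ℝ (Fin 3))) :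
        EuclideanSpace ℝ (Fin 3) → ℝ) (ρ⁻¹ • (y - x₀)) = 0 := by
  refine ContDiffBump.zero_of_le_dist _ ?_
  rw [dist_zero_right, norm_smul, norm_inv, Real.norm_of_nonneg hρ.le]
  rw [mem_ball, dist_eq_norm, not_lt] at hy
  show (2 : ℝ) ≤ ρ⁻¹ * ‖y - x₀‖
  rw [le_inv_mul_iff₀ hρ]
  linarith

/-- For every `y`, eventually (as `ρ → ∞`) `g_ρ(y) = 1`. -/
theorem fpl_trunc_eventually_one (x₀ y : EuclideanSpace ℝ (Fin 3)) :
    ∀ᶠ ρ : ℝ in atTop,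
      ((⟨1, 2, zero_lt_one, one_lt_two⟩ : ContDiffBump (0 : EuclideanSpace ℝ (Fin 3))) :
        EuclideanSpace ℝ (Fin 3) → ℝ) (ρ⁻¹ • (y - x₀)) = 1 := by
  filter_upwards [eventually_ge_atTop (‖y - x₀‖ + 1)] with ρ hρ
  have hρ0 : 0 < ρ := by linarith [norm_nonneg (y - x₀)]
  exact fpl_trunc_eq_one hρ0 (by rw [mem_closedBall, dist_eq_norm]; linarith)

/-! ### `L¹` bookkeeping on balls -/

/-- Volume of a ball of `ℝ³`: `|B(c, r)| = r³ |B₁|`. -/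
theorem fpl_volume_ball_toReal (c : EuclideanSpace ℝ (Fin 3)) {r : ℝ} (hr : 0 ≤ r) :
    (volume (ball c r)).toReal = r ^ 3 * (volume (ball (0 : EuclideanSpace ℝ (Fin 3)) 1)).toReal := by
  rw [Measure.addHaar_ball volume c hr, ENNReal.toReal_mul, finrank_euclideanSpace_fin,
    ENNReal.toReal_ofReal (by positivity)]

/-- From an `L²` bound `∫ f² ≤ c₀ ρ³` to an `L¹` bound on the ball:
`∫_{B(c,ρ)} |f| ≤ ρ³ √(|B₁| c₀)`. -/
theorem fpl_setIntegral_abs_le_of_sq_le {f : EuclideanSpace ℝ (Fin 3) → ℝ} (hf : MemLp f 2 volume)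
    (c : EuclideanSpace ℝ (Fin 3)) {ρ c₀ : ℝ} (hρ : 0 < ρ) (hc₀ : 0 ≤ c₀)
    (hsq : ∫ y, f y ^ 2 ≤ c₀ * ρ ^ 3) :
    ∫ y in ball c ρ, |f y| ≤
      ρ ^ 3 * Real.sqrt ((volume (ball (0 : EuclideanSpace ℝ (Fin 3)) 1)).toReal * c₀) := by
  set V : ℝ := (volume (ball (0 : EuclideanSpace ℝ (Fin 3)) 1)).toReal with hV
  have hV0 : 0 ≤ V := ENNReal.toReal_nonneg
  refine (fpl_setIntegral_abs_le_sqrt hf c ρ).trans ?_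
  rw [fpl_volume_ball_toReal c hρ.le, ← hV]
  calc Real.sqrt (ρ ^ 3 * V) * Real.sqrt (∫ y, f y ^ 2)
      ≤ Real.sqrt (ρ ^ 3 * V) * Real.sqrt (c₀ * ρ ^ 3) :=
        mul_le_mul_of_nonneg_left (Real.sqrt_le_sqrt hsq) (Real.sqrt_nonneg _)
    _ = ρ ^ 3 * Real.sqrt (V * c₀) := by
        rw [← Real.sqrt_mul (by positivity), show ρ ^ 3 * V * (c₀ * ρ ^ 3) = (V * c₀) * (ρ ^ 3) ^ 2 by ring,
          Real.sqrt_mul (by positivity), Real.sqrt_sq (by positivity), mul_comm]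

/-- **The `L¹(B_ρ)` bound for `H = q - p₁ - Q`**: if `|q| ≤ |q x₀| + Lρ` on `B(x₀,ρ)`,
`∫ p₁² ≤ P ρ³` and `∫ Q² ≤ 9 P ρ³` (`p₁, Q ∈ L²`, all continuous), then
`∫_{B(x₀,ρ)} |q - p₁ - Q| ≤ L|B₁| ρ⁴ + (|q x₀| |B₁| + 4 √(|B₁| P)) ρ³`. -/
theorem fpl_L1_ball_bound {q p₁ Q : EuclideanSpace ℝ (Fin 3) → ℝ} (hq : Continuous q)
    (hp : Continuous p₁) (hQ : Continuous Q) (hpm : MemLp p₁ 2 volume) (hQm : MemLp Q 2 volume)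
    {x₀ : EuclideanSpace ℝ (Fin 3)} {ρ L P : ℝ} (hρ : 0 < ρ) (hP : 0 ≤ P)
    (hqb : ∀ y ∈ ball x₀ ρ, |q y| ≤ |q x₀| + L * ρ) (hpsq : ∫ y, p₁ y ^ 2 ≤ P * ρ ^ 3)
    (hQsq : ∫ y, Q y ^ 2 ≤ 9 * P * ρ ^ 3) :
    ∫ y in ball x₀ ρ, |q y - p₁ y - Q y| ≤
      L * (volume (ball (0 : EuclideanSpace ℝ (Fin 3)) 1)).toReal * ρ ^ 4 +
        (|q x₀| * (volume (ball (0 : EuclideanSpace ℝ (Fin 3)) 1)).toReal +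
          4 * Real.sqrt ((volume (ball (0 : EuclideanSpace ℝ (Fin 3)) 1)).toReal * P)) * ρ ^ 3 := by
  set V : ℝ := (volume (ball (0 : EuclideanSpace ℝ (Fin 3)) 1)).toReal with hV
  have hV0 : 0 ≤ V := ENNReal.toReal_nonneg
  have hic : ∀ {f : EuclideanSpace ℝ (Fin 3) → ℝ}, Continuous f → IntegrableOn f (ball x₀ ρ) volume :=
    fun hf => (hf.continuousOn.integrableOn_compact (isCompact_closedBall x₀ ρ)).mono_set
      ball_subset_closedBall
  -- the three pieces
  have hIq : ∫ y in ball x₀ ρ, |q y| ≤ (|q x₀| + L * ρ) * (ρ ^ 3 * V) := by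
    calc ∫ y in ball x₀ ρ, |q y| ≤ ∫ _y in ball x₀ ρ, (|q x₀| + L * ρ) :=
          setIntegral_mono_on (hic (continuous_abs.comp hq)) (integrableOn_const measure_ball_lt_top.ne)
            measurableSet_ball hqb
      _ = (|q x₀| + L * ρ) * (ρ ^ 3 * V) := by
          rw [setIntegral_const, smul_eq_mul, measureReal_def, fpl_volume_ball_toReal x₀ hρ.le, ← hV,
            mul_comm]
  have hIp : ∫ y in ball x₀ ρ, |p₁ y| ≤ ρ ^ 3 * Real.sqrt (V * P) :=
    fpl_setIntegral_abs_le_of_sq_le hpm x₀ hρ hP hpsq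
  have hIQ : ∫ y in ball x₀ ρ, |Q y| ≤ ρ ^ 3 * Real.sqrt (V * (9 * P)) :=
    fpl_setIntegral_abs_le_of_sq_le hQm x₀ hρ (by positivity) (by simpa only [mul_assoc] using hQsq)
  have h9 : Real.sqrt (V * (9 * P)) = 3 * Real.sqrt (V * P) := by
    rw [show V * (9 * P) = 3 ^ 2 * (V * P) by ring, Real.sqrt_mul (by positivity),
      Real.sqrt_sq (by norm_num)]
  rw [h9] at hIQ
  -- pointwise triangle inequality and splitting of the integral
  have habs : ∀ y, |q y - p₁ y - Q y| ≤ |q y| + |p₁ y| + |Q y| := fun y =>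
    calc |q y - p₁ y - Q y| ≤ |q y - p₁ y| + |Q y| := abs_sub _ _
      _ ≤ |q y| + |p₁ y| + |Q y| := by gcongr; exact abs_sub _ _
  have iq : IntegrableOn (fun y => |q y|) (ball x₀ ρ) volume := hic (continuous_abs.comp hq)
  have ip : IntegrableOn (fun y => |p₁ y|) (ball x₀ ρ) volume := hic (continuous_abs.comp hp)
  have iQ : IntegrableOn (fun y => |Q y|) (ball x₀ ρ) volume := hic (continuous_abs.comp hQ)
  have iH : IntegrableOn (fun y => |q y - p₁ y - Q y|) (ball x₀ ρ) volume :=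
    hic (continuous_abs.comp ((hq.sub hp).sub hQ))
  have iqp : IntegrableOn (fun y => |q y| + |p₁ y|) (ball x₀ ρ) volume := iq.add ip
  have iqpQ : IntegrableOn (fun y => |q y| + |p₁ y| + |Q y|) (ball x₀ ρ) volume := iqp.add iQ
  calc ∫ y in ball x₀ ρ, |q y - p₁ y - Q y| ≤ ∫ y in ball x₀ ρ, (|q y| + |p₁ y| + |Q y|) :=
      setIntegral_mono_on iH iqpQ measurableSet_ball (fun y _ => habs y)
    _ = (∫ y in ball x₀ ρ, |q y|) + (∫ y in ball x₀ ρ, |p₁ y|) + ∫ y in ball x₀ ρ, |Q y| := by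
      rw [integral_add iqp iQ, integral_add iq ip]
    _ ≤ (|q x₀| + L * ρ) * (ρ ^ 3 * V) + ρ ^ 3 * Real.sqrt (V * P) + ρ ^ 3 * (3 * Real.sqrt (V * P)) :=
      add_le_add (add_le_add hIq hIp) hIQ
    _ = L * V * ρ ^ 4 + (|q x₀| * V + 4 * Real.sqrt (V * P)) * ρ ^ 3 := by ring

/-- Registered form (sub-goal `fpl_sliceDecompTools_main` of crux stmt-NavierStokesRegularity-14060):
the `L¹(B_ρ)` bound for `q - p₁ - Q`. -/
theorem fpl_sliceDecompTools_main :
    ∀ (q p₁ Q : EuclideanSpace ℝ (Fin 3) → ℝ), Continuous q → Continuous p₁ → Continuous Q →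
    MeasureTheory.MemLp p₁ 2 MeasureTheory.volume → MeasureTheory.MemLp Q 2 MeasureTheory.volume →
    ∀ (x₀ : EuclideanSpace ℝ (Fin 3)) (ρ L P : ℝ), 0 < ρ → 0 ≤ P →
    (∀ y ∈ Metric.ball x₀ ρ, |q y| ≤ |q x₀| + L * ρ) → (∫ y, p₁ y ^ 2 ≤ P * ρ ^ 3) →
    (∫ y, Q y ^ 2 ≤ 9 * P * ρ ^ 3) →
    ∫ y in Metric.ball x₀ ρ, |q y - p₁ y - Q y| ≤
      L * (MeasureTheory.volume (Metric.ball (0 : EuclideanSpace ℝ (Fin 3)) 1)).toReal * ρ ^ 4 +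
        (|q x₀| * (MeasureTheory.volume (Metric.ball (0 : EuclideanSpace ℝ (Fin 3)) 1)).toReal +
          4 * Real.sqrt ((MeasureTheory.volume (Metric.ball (0 : EuclideanSpace ℝ (Fin 3)) 1)).toReal * P)) *
          ρ ^ 3 :=
  fun _ _ _ hq hp hQ hpm hQm _ _ _ _ hρ hP hqb hpsq hQsq =>
    fpl_L1_ball_bound hq hp hQ hpm hQm hρ hP hqb hpsq hQsq

end Summit.NavierStokesRegularity.NavierStokesRegularity.Theorems

end
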